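import Summits.QuantumFields.YangMills.Theorems.UnitScaleTiltHalvingP1FlatPillarPrime
import HarnessLib

/-!
# Route `UnitScaleTilt`, crux K1 «MinimiserStabilityRegPr» (stmt-QuantumFields-19200), registered stub V2′ `stub_halvingStep` (`BirthV10`) — (K-E2E) door, C_E end,
# piece F2 of the L4 queue, file 1∕2: **THE PLAQUETTE SPLIT `Tch`∕`hTN`∕`hTF` OF ✓`HalvingSitePackage.ceRows_at_member(_exists)` (L3∕L3′ :160–:162)** for the aligned cube
# sequence `𝒟 := cubeSeqMT3 F n K x ρ S M hM` with `Near b :↔ b₋ ∈ □₀ ∧ b₊ ∈ □₀`, `□₀ := cubeSetM x (K−n) ρ S M 0` (LEAD-H RULING L-6) and the CLOSED spelling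
# `Tch := fun p => ¬ (𝒟.LamBond 0 ⟨p.src, p.μ⟩ ∧ 𝒟.LamBond 0 ⟨p.src.shift p.μ, p.ν⟩ ∧ 𝒟.LamBond 0 ⟨p.src.shift p.ν, p.μ⟩ ∧ 𝒟.LamBond 0 ⟨p.src, p.ν⟩)`; the two `Near` containment clauses
# `hNearIdx`∕`hNearΩ` of B4 §3 are ym-inputs-p09's ✓`P1FlatCoreTopCubeGeometry.near_of_bondIdx`∕`near_of_mem_Om_succ` (J1c, landed first — cited, not restated); file 2∕2
# ✓`…HalvingStepOfPillarsCESU2Gauge` (p630872) does the `U(2) → SU(2)` normalisation of the P1♭′ chart pair (`uS`∕`hchartNear`)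

Cell `ym3-torus` (HUMAN RULING D-0037, YM ladder rung R3 — continuum SU(2) YM₃ on the torus is a RUNG, not the Clay problem), width seat `ym-ust-19200-w7` gen 1
(D-0154 (3c)).  `--supports stmt-QuantumFields-19200 --as helper`; def-free, 0 sorry, standard axioms.  Consumer: ★w8-19200 g2's L4 `ceRows_of_chart` (the door's `hCE′`
binder), which passes `hTN`∕`hTF` below by `exact`.

WHY.  L3′ reads the competitor map through an abstract plaquette predicate `Tch` («touches the chart region») with two clauses: `hTN` — every side of a `Tch`-plaquette is
charted (`Near`), and `hTF` — every side of a non-`Tch` plaquette lies in `Λ₀` (`𝒟.LamBond 0`, where a level-`0` index datum IS the bond variable, so the competitor is pinned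
there).  With the closed spelling above `hTF` is double negation, and `hTN` is torus bookkeeping: a side outside `Λ₀` has a DEEP end (`blockOf c ∈ Ω₁ = □₁`, ✓`lamBond_zero_iff`),
and by (2.2) at level `0` (✓`HalvingP1FlatPillarPrime.sep22_cubeFinM_zero`) every fine site within `dist₀ < S + 1` of a deep site lies in `□₀`; the corners of one plaquette are
pairwise at `dist₀ ≤ 1` (✓`corner_dist_le_one`), so `1 ≤ S` suffices.

WHAT THIS FILE PROVES (no definition, no sorry):
* `corner_mem_cube0_of_deep` — every `{0,1}`-corner over a deep corner lies in `□₀` (`1 ≤ S`);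
* ★ **`near_sides_of_touch`** = L3's `hTN` VERBATIM for `Near := fun b => b.src ∈ □₀ ∧ b.tgt ∈ □₀` (beta-unfolded at the four sides) and the closed `Tch` above (premise `1 ≤ S`);
* **`lamBond_sides_of_not_touch`** = L3's `hTF` VERBATIM for that `Tch` (any `Domains`).
HONEST SCOPE.  Torus geometry only; NOT a claim about the stub, the crux, the rung or the mass gap; no summit statement is proved by this seat.

References: T. Bałaban, CMP **96** (1984) 223–250 [Balaban1984PropagatorsII] (2.1)–(2.4) p.224; CMP **102** (1985) 277–309 [Balaban1985Variational] (144) p.300, (150)–(152) p.301,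
(156)–(158) p.302; CMP **99** (1985) 75–102 [Balaban1985RegularSpaces] p.77 (lattice conventions).
-/

set_option autoImplicit false

noncomputable section

open scoped BigOperators Matrix.Norms.L2Operator

namespace Summit.QuantumFields.YangMills.Theorems.HalvingCENear

open Literature.MathematicalPhysics.QuantumFieldTheory.Balaban1983to89
open Literature.MathematicalPhysics.QuantumFieldTheory.Balaban1983to89.T3ContinuumYM3Torus
open Complex (I)
open B5Eq117TorusCarriers (Mk)
open B5Prop12FieldsLattice (distSite)
open B6SectADomainsV1 (Domains)
open B7Prop1Explicit (e)
open B10Eq27TorusAxialLog (transl transl_add_e transl_rel)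
open FlatCubeSequenceAligned (cubeSeqMT3 cubeSeqM cubeSeqM_Om_pos cubeSetM cubeFinM)
open HalvingSiteAssembly (e_apply_mem01 e_add_e_apply_mem01)
open HalvingP1FlatPillarPrime (mem_cubeSetM_zero_iff sep22_cubeFinM_zero corner_dist_le_one)

/-! ## §1 The plaquette split of L3: `Tch p` := «some side of `p` is not in `Λ₀`» -/

section Plaquettes

variable {F : T3Family} {n K : ℕ}

/-- **EVERY `{0,1}`-CORNER OVER A DEEP CORNER LIES IN `□₀`** (aligned cube sequence, separation `S ≥ 1`): if `0 + (z₀ + a₀)` has its block in `Ω₁` then every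
`0 + (z₀ + a)` with coordinates of `a` in `{0,1}` lies in `□₀` — (2.2) at level `0` and `dist₀ ≤ 1 < S + 1`.
[cite: Balaban1984PropagatorsII, (2.1)-(2.2) p.224; Balaban1985Variational, (144) p.300] -/
theorem corner_mem_cube0_of_deep (x : Site (F.P K) 0) (ρ S M : ℕ) (hM : 1 ≤ M) (hS : 1 ≤ S) (z₀ a₀ : B7Prop1Explicit.Site (F.P K).d)
    (ha₀ : ∀ i, a₀ i = 0 ∨ a₀ i = 1) (hdeep : (cubeSeqMT3 F n K x ρ S M hM).Deep 0 (transl (0 : Site (F.P K) 0) (z₀ + a₀)))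
    (a : B7Prop1Explicit.Site (F.P K).d) (ha : ∀ i, a i = 0 ∨ a i = 1) :
    transl (0 : Site (F.P K) 0) (z₀ + a) ∈ cubeSetM x (K - n) ρ S M 0 := by
  have hk := FlatMinimizerH.le_T3 F n K
  have h' : blockOf (transl (0 : Site (F.P K) 0) (z₀ + a₀)) ∈ (cubeSeqM x (K - n) hk ρ S M hM).Om 1 := hdeep
  have hk1 : 1 ≤ K - n := by
    by_contra hlt
    rw [(cubeSeqM x (K - n) hk ρ S M hM).Om_eq_empty (show (cubeSeqM x (K - n) hk ρ S M hM).k < 1 by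
      simp only [FlatCubeSequenceAligned.cubeSeqM_k]; omega)] at h'
    simp at h'
  have hblk : blockOf (transl (0 : Site (F.P K) 0) (z₀ + a₀)) ∈ cubeFinM x (K - n) ρ S M 1 := by
    rwa [cubeSeqM_Om_pos x hk ρ S M hM le_rfl hk1] at h'
  rw [mem_cubeSetM_zero_iff]
  by_contra hout
  have hsep := sep22_cubeFinM_zero x hk hk1 ρ S M hM _ _ hblk hout
  have hd := corner_dist_le_one (P := F.P K) z₀ a₀ a ha₀ ha
  have hS1 : (1 : ℝ) ≤ (S : ℝ) := by exact_mod_cast hS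
  linarith

/-- ★ **`hTN` OF ✓`HalvingSitePackage.ceRows_at_member` FOR `Near` := «both ends in `□₀`», `Tch p` := «not all four sides of `p` lie in `Λ₀`»** (separation `S ≥ 1`): a
plaquette with a side outside `Λ₀` has a deep corner, so all four sides have both ends in `□₀`.
[cite: Balaban1984PropagatorsII, (2.1)-(2.4) p.224; Balaban1985Variational, (144) p.300, (150)-(152) p.301] -/
theorem near_sides_of_touch (x : Site (F.P K) 0) (ρ S M : ℕ) (hM : 1 ≤ M) (hS : 1 ≤ S) :
    ∀ p : Plaq (F.P K) 0,
      ¬ ((cubeSeqMT3 F n K x ρ S M hM).LamBond 0 ⟨p.src, p.μ⟩ ∧ (cubeSeqMT3 F n K x ρ S M hM).LamBond 0 ⟨p.src.shift p.μ, p.ν⟩ ∧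
          (cubeSeqMT3 F n K x ρ S M hM).LamBond 0 ⟨p.src.shift p.ν, p.μ⟩ ∧ (cubeSeqMT3 F n K x ρ S M hM).LamBond 0 ⟨p.src, p.ν⟩) →
      ((⟨p.src, p.μ⟩ : PBond (F.P K) 0).src ∈ cubeSetM x (K - n) ρ S M 0 ∧ (⟨p.src, p.μ⟩ : PBond (F.P K) 0).tgt ∈ cubeSetM x (K - n) ρ S M 0) ∧
      ((⟨p.src.shift p.μ, p.ν⟩ : PBond (F.P K) 0).src ∈ cubeSetM x (K - n) ρ S M 0 ∧ (⟨p.src.shift p.μ, p.ν⟩ : PBond (F.P K) 0).tgt ∈ cubeSetM x (K - n) ρ S M 0) ∧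
      ((⟨p.src.shift p.ν, p.μ⟩ : PBond (F.P K) 0).src ∈ cubeSetM x (K - n) ρ S M 0 ∧ (⟨p.src.shift p.ν, p.μ⟩ : PBond (F.P K) 0).tgt ∈ cubeSetM x (K - n) ρ S M 0) ∧
      ((⟨p.src, p.ν⟩ : PBond (F.P K) 0).src ∈ cubeSetM x (K - n) ρ S M 0 ∧ (⟨p.src, p.ν⟩ : PBond (F.P K) 0).tgt ∈ cubeSetM x (K - n) ρ S M 0) := by
  intro p hp
  set Dm := cubeSeqMT3 F n K x ρ S M hM with hDm
  have hμν : p.μ ≠ p.ν := p.hμν.ne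
  -- the corners as translates of `z₀ := p.src − 0`
  set z₀ : B7Prop1Explicit.Site (F.P K).d := B10Eq27TorusAxialLog.rel (0 : Site (F.P K) 0) p.src with hz₀
  have hs : transl (0 : Site (F.P K) 0) z₀ = p.src := transl_rel _ _
  have hs0 : transl (0 : Site (F.P K) 0) (z₀ + 0) = p.src := by rw [add_zero, hs]
  have hsμ : transl (0 : Site (F.P K) 0) (z₀ + e p.μ) = p.src.shift p.μ := by rw [transl_add_e, hs]
  have hsν : transl (0 : Site (F.P K) 0) (z₀ + e p.ν) = p.src.shift p.ν := by rw [transl_add_e, hs]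
  have hsμν : transl (0 : Site (F.P K) 0) (z₀ + (e p.μ + e p.ν)) = (p.src.shift p.μ).shift p.ν := by rw [← add_assoc, transl_add_e, hsμ]
  have hsνμ : transl (0 : Site (F.P K) 0) (z₀ + (e p.ν + e p.μ)) = (p.src.shift p.ν).shift p.μ := by rw [← add_assoc, transl_add_e, hsν]
  -- a deep corner exists
  obtain ⟨a₀, ha₀, hdeep⟩ : ∃ a₀ : B7Prop1Explicit.Site (F.P K).d, (∀ i, a₀ i = 0 ∨ a₀ i = 1) ∧ Dm.Deep 0 (transl (0 : Site (F.P K) 0) (z₀ + a₀)) := by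
    by_contra hnone'
    have hnone : ∀ a : B7Prop1Explicit.Site (F.P K).d, (∀ i, a i = 0 ∨ a i = 1) → ¬ Dm.Deep 0 (transl (0 : Site (F.P K) 0) (z₀ + a)) :=
      fun a ha hd => hnone' ⟨a, ha, hd⟩
    apply hp
    refine ⟨(Dm.lamBond_zero_iff _).2 ⟨?_, ?_⟩, (Dm.lamBond_zero_iff _).2 ⟨?_, ?_⟩, (Dm.lamBond_zero_iff _).2 ⟨?_, ?_⟩, (Dm.lamBond_zero_iff _).2 ⟨?_, ?_⟩⟩
    · rw [← hs0]; exact hnone 0 (fun i => Or.inl rfl)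
    · show ¬ Dm.Deep 0 (p.src.shift p.μ)
      rw [← hsμ]; exact hnone _ (e_apply_mem01 p.μ)
    · rw [← hsμ]; exact hnone _ (e_apply_mem01 p.μ)
    · show ¬ Dm.Deep 0 ((p.src.shift p.μ).shift p.ν)
      rw [← hsμν]; exact hnone _ (e_add_e_apply_mem01 hμν)
    · rw [← hsν]; exact hnone _ (e_apply_mem01 p.ν)
    · show ¬ Dm.Deep 0 ((p.src.shift p.ν).shift p.μ)
      rw [← hsνμ]; exact hnone _ (e_add_e_apply_mem01 hμν.symm)
    · rw [← hs0]; exact hnone 0 (fun i => Or.inl rfl)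
    · show ¬ Dm.Deep 0 (p.src.shift p.ν)
      rw [← hsν]; exact hnone _ (e_apply_mem01 p.ν)
  have key := corner_mem_cube0_of_deep x ρ S M hM hS z₀ a₀ ha₀ hdeep
  refine ⟨⟨?_, ?_⟩, ⟨?_, ?_⟩, ⟨?_, ?_⟩, ⟨?_, ?_⟩⟩
  · rw [← hs0]; exact key 0 (fun i => Or.inl rfl)
  · show p.src.shift p.μ ∈ _
    rw [← hsμ]; exact key _ (e_apply_mem01 p.μ)
  · rw [← hsμ]; exact key _ (e_apply_mem01 p.μ)
  · show (p.src.shift p.μ).shift p.ν ∈ _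
    rw [← hsμν]; exact key _ (e_add_e_apply_mem01 hμν)
  · rw [← hsν]; exact key _ (e_apply_mem01 p.ν)
  · show (p.src.shift p.ν).shift p.μ ∈ _
    rw [← hsνμ]; exact key _ (e_add_e_apply_mem01 hμν.symm)
  · rw [← hs0]; exact key 0 (fun i => Or.inl rfl)
  · show p.src.shift p.ν ∈ _
    rw [← hsν]; exact key _ (e_apply_mem01 p.ν)

/-- **`hTF` OF ✓`HalvingSitePackage.ceRows_at_member` FOR `Tch p` := «not all four sides of `p` lie in `Λ₀`»**: off `Tch` all four sides lie in `Λ₀` (double negation).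
[cite: Balaban1984PropagatorsII, (2.3)-(2.4) p.224] -/
theorem lamBond_sides_of_not_touch (D : Domains (F.P K)) :
    ∀ p : Plaq (F.P K) 0,
      ¬ ¬ (D.LamBond 0 ⟨p.src, p.μ⟩ ∧ D.LamBond 0 ⟨p.src.shift p.μ, p.ν⟩ ∧ D.LamBond 0 ⟨p.src.shift p.ν, p.μ⟩ ∧ D.LamBond 0 ⟨p.src, p.ν⟩) →
      D.LamBond 0 ⟨p.src, p.μ⟩ ∧ D.LamBond 0 ⟨p.src.shift p.μ, p.ν⟩ ∧ D.LamBond 0 ⟨p.src.shift p.ν, p.μ⟩ ∧ D.LamBond 0 ⟨p.src, p.ν⟩ :=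
  fun _ h => not_not.1 h

end Plaquettes



end Summit.QuantumFields.YangMills.Theorems.HalvingCENear

end
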